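import Mathlib.Algebra.Category.MonCat.FilteredColimits
import Literature.AlgebraicGeometry.Frobenioids.PadicFrobenioidPairIso
import HarnessLib

/-!
# Frobenioids II, Thm. 2.4 (ii): the direct limits `lim→ K_{A_j}^×` EXIST — the printed pair, binder-free

Mochizuki, *The geometry of Frobenioids II*, Kyushu J. Math. **62** (2008) 401–460, §2, proof of Theorem 2.4 (ii),
author's text p. 20 l.−5 – p. 21 l. 6 [cite: MochizukiFrdII2008, Thm 2.4 (ii) p.21]: "it follows — by varying the
objects `Aᵢ` and reconstructing the multiplicative group associated to the field determined by the image of `Aᵢ` …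
as the groupification of the monoid `O^▷(Aᵢ)` — that `Ψ` induces a pair of compatible isomorphisms `G₁ ⥲ G₂`;
`K̄₁^× ⥲ K̄₂^×`".

PROOF-ONLY COMPANION (cell abc-iut, `plan/L1/SUBDAG-FrdII-Thm24.md` row W12-L17; RQ7 audit note K-1 of abc-iut-w5-d229
on p422264).  The direct limits "`K̄ᵢ^× = lim→ K_{A_j}^×`" of the printed argument are colimits of `ℕ`-indexed (more
generally: small filtered) diagrams of commutative monoids.  Mathlib constructs these colimits explicitly
(`CommMonCat.FilteredColimits.colimitCoconeIsColimit`) but registers no `HasColimitsOfShape` instance for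
`CommMonCat`, so the theorems of `PadicFrobenioidFieldUnitsEquivariance` (abc-iut-w5-d188) and
`PadicFrobenioidPairIso` (abc-iut-w5-d194) carry `[HasColimit …]` instance hypotheses that `inferInstance` cannot
discharge.  This file discharges them once and for all and restates the printed pair WITHOUT instance hypotheses:

* `hasColimitsOfShape_commMonCat_of_isFiltered` / `hasColimit_commMonCat_of_isFiltered` — small filtered colimits of
  commutative monoids exist;
* `PadicFrd.hasColimit_bZeroOn`, `PadicFrd.Datum.hasColimit_B`, `PadicFrd.Datum.hasColimit_Φ` — in particular every
  direct limit `lim→_j K_{A_j}^×`, `lim→_j B(A_j)`, `lim→_j Φ(A_j)` along a small filtered system of objects exists;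
* `PadicFrd.exists_fieldUnits_colimit_iso_equivariant_of_isFiltered` — abc-iut-w5-d188's (δ) along any small
  filtered system, no instance hypotheses;
* `BaseGaloisSystem.exists_pairIso_of_isFieldwiseSaturated` — **the printed pair** `φ : Π₁ ≃* Π₂` (lying over
  print's `G₁ ⥲ G₂` via Thm. 1.2 (ii), not typed here), `e : lim→_k K_{1,Π₁/N_k}^× ≅ lim→_k K_{2,Π₂/N₂,k}^×`,
  `e ∘ r_g = r_{φ g} ∘ e`, for fieldwise saturated data over the small bases `CosetCat Πᵢ` — abc-iut-w5-d194's
  `exists_pairIso` with its five `HasColimit` hypotheses removed.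
Theorems only; no new definitions, no instances declared; nothing here bears on [IUTchIII] Cor. 3.12.
-/

noncomputable section

namespace Literature.AlgebraicGeometry.Frobenioids

open CategoryTheory CategoryTheory.Limits Opposite Topology Filter
open Literature.AnabelianGeometry.SemiGraphs

universe w' w v v₂ u

/-! ### Small filtered colimits of commutative monoids exist -/

/-- Small filtered colimits of commutative monoids exist (Mathlib's explicit construction
`CommMonCat.FilteredColimits.colimitCocone`, packaged as `HasColimit`; index category in `Type`). In the printed
argument: the direct limit "`lim→ K_{A_j}^×`" over a cofinal system of objects is a commutative monoid.
[cite: MochizukiFrdII2008, Thm 2.4 (ii) p.21] -/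
theorem hasColimit_commMonCat_of_isFiltered {J : Type} [SmallCategory J] [IsFiltered J] (F : J ⥤ CommMonCat.{u}) :
    HasColimit F :=
  HasColimit.mk ⟨_, CommMonCat.FilteredColimits.colimitCoconeIsColimit.{0, u} F⟩

/-- The same, for an index category in an arbitrary universe `w` and monoids in universe `max w u`.
[cite: MochizukiFrdII2008, Thm 2.4 (ii) p.21] -/
theorem hasColimit_commMonCat_of_isFiltered' {J : Type w} [SmallCategory J] [IsFiltered J]
    (F : J ⥤ CommMonCat.{max w u}) : HasColimit F :=
  HasColimit.mk ⟨_, CommMonCat.FilteredColimits.colimitCoconeIsColimit.{w, u} F⟩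

/-- `CommMonCat` has all colimits of small filtered shape (index category in `Type`), as a `Prop` to be invoked with
`haveI` (no global instance is declared here). [cite: MochizukiFrdII2008, Thm 2.4 (ii) p.21] -/
theorem hasColimitsOfShape_commMonCat_of_isFiltered (J : Type) [SmallCategory J] [IsFiltered J] :
    HasColimitsOfShape J CommMonCat.{u} :=
  ⟨fun F => hasColimit_commMonCat_of_isFiltered F⟩

/-- In particular `ℕ`-indexed direct limits of commutative monoids exist (the universal pro-covering
`(Π/N_k)_{k ∈ ℕ}` of the base is `ℕ`-indexed). [cite: MochizukiFrdII2008, Thm 2.4 (ii) p.21] -/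
theorem hasColimitsOfShape_nat_commMonCat : HasColimitsOfShape ℕ CommMonCat.{u} :=
  hasColimitsOfShape_commMonCat_of_isFiltered ℕ

namespace PadicFrd

variable {D : Type u} [Category.{v} D] {p : ℕ} [Fact p.Prime]

omit [Fact p.Prime] in
/-- `lim→_j K_{A_j}^×` exists: the direct limit of `B₀|_D = (Spec K ↦ K^×)` along any small filtered system of objects
of the base. [cite: MochizukiFrdII2008, Thm 2.4 (ii) p.21] -/
theorem hasColimit_bZeroOn (base : D ⥤ PadicFld.{u} p) {J : Type} [SmallCategory J] [IsFiltered J] (c : J ⥤ Dᵒᵖ) :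
    HasColimit (c ⋙ bZeroOn base) :=
  hasColimit_commMonCat_of_isFiltered _

omit [Fact p.Prime] in
/-- `lim→_j Φ₀(A_j)` exists likewise. [cite: MochizukiFrdII2008, Thm 2.4 (ii) p.21] -/
theorem hasColimit_phiZeroOn (base : D ⥤ PadicFld.{u} p) {J : Type} [SmallCategory J] [IsFiltered J] (c : J ⥤ Dᵒᵖ) :
    HasColimit (c ⋙ phiZeroOn base) :=
  hasColimit_commMonCat_of_isFiltered _

/-- `lim→_j B(A_j)` exists for the rational-function monoid `B` of a `p`-adic Frobenioid datum, along any small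
filtered system (print's condition (a) p.20 quantifies over "the inductive limit monoid"). [cite: MochizukiFrdII2008, Thm 2.4 (i) p.20] -/
theorem Datum.hasColimit_B (d : Datum D p) {J : Type} [SmallCategory J] [IsFiltered J] (c : J ⥤ Dᵒᵖ) :
    HasColimit (c ⋙ d.B) :=
  hasColimit_commMonCat_of_isFiltered _

/-- `lim→_j Φ(A_j)` exists for the divisor monoid `Φ` ("the inductive limit monoid `lim→ Φᵢ(B)`", condition (a) of the
proof of Thm. 2.4 (i), p. 20). [cite: MochizukiFrdII2008, Thm 2.4 (i) p.20] -/
theorem Datum.hasColimit_Φ (d : Datum D p) {J : Type} [SmallCategory J] [IsFiltered J] (c : J ⥤ Dᵒᵖ) :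
    HasColimit (c ⋙ d.Φ) :=
  hasColimit_commMonCat_of_isFiltered _

/-! ### (δ) along a small filtered system, no instance hypotheses -/

variable {D₁ : Type u} [Category.{v} D₁] {D₂ : Type u} [Category.{v₂} D₂] {p₁ p₂ : ℕ}
  [Fact p₁.Prime] [Fact p₂.Prime] (d₁ : Datum D₁ p₁) (d₂ : Datum D₂ p₂)

/-- **(δ), binder-free along small filtered systems.**  abc-iut-w5-d188's
`exists_fieldUnits_colimit_iso_equivariant` (for fieldwise saturated `Φ₁`, `Φ₂`, the base equivalence `E = Ψ^Base`
and the row-L02 slot `ΨB : B₁ ≅ E^op ⋙ B₂`: an isomorphism `lim→_j K_{1,A_j}^× ≅ lim→_j K_{2,Ψ A_j}^×` intertwining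
every endomorphism `σ` of the system with `Ψ^Base(σ)`) with its four `HasColimit` hypotheses DISCHARGED for any small
filtered index category (e.g. `ℕ`). [cite: MochizukiFrdII2008, Thm 2.4 (ii) p.21] -/
theorem exists_fieldUnits_colimit_iso_equivariant_of_isFiltered (hfs₁ : d₁.IsFieldwiseSaturated)
    (hfs₂ : d₂.IsFieldwiseSaturated) (E : D₁ ≌ D₂) (ΨB : d₁.B ≅ E.functor.op ⋙ d₂.B)
    {J : Type} [SmallCategory J] [IsFiltered J] (c : J ⥤ D₁ᵒᵖ) :
    haveI := hasColimitsOfShape_commMonCat_of_isFiltered.{u} J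
    ∃ e : colimit (c ⋙ bZeroOn d₁.base) ≅ colimit ((c ⋙ E.functor.op) ⋙ bZeroOn d₂.base),
      ∀ σ : c ⟶ c,
        e.hom ≫ colimMap (Functor.whiskerRight (Functor.whiskerRight σ E.functor.op) (bZeroOn d₂.base)) =
          colimMap (Functor.whiskerRight σ (bZeroOn d₁.base)) ≫ e.hom := by
  haveI := hasColimitsOfShape_commMonCat_of_isFiltered.{u} J
  exact exists_fieldUnits_colimit_iso_equivariant d₁ d₂ hfs₁ hfs₂ E ΨB c

end PadicFrd

/-! ### The printed pair, binder-free -/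

namespace BaseGaloisSystem

variable {G : Type u} [Group G] [TopologicalSpace G] (hG : IsTempered G)
  {G₂ : Type u} [Group G₂] [TopologicalSpace G₂] [IsTopologicalGroup G₂] (hG₂ : IsTempered G₂)
  (N : ℕ → OpenNormalSubgroup G) (hN : Antitone N)
  {p₁ p₂ : ℕ} [Fact p₁.Prime] [Fact p₂.Prime]
  (d₁ : PadicFrd.Datum (CosetCat G) p₁) (d₂ : PadicFrd.Datum (CosetCat G₂) p₂)

include hG hG₂ in
/-- **[FrdII] Thm. 2.4 (ii), the compatible pair — no instance hypotheses.**  For FIELDWISE SATURATED `p`-adic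
Frobenioid data over the small bases `CosetCat Π₁`, `CosetCat Π₂` (`Πᵢ` tempered), an equivalence of bases
`E = Ψ^Base` with the row-L02 slot `ΨB : B₁ ≅ E^op ⋙ B₂`, and a cofinal antitone sequence `N` of open normal
subgroups of `Π₁`: there are `φ : Π₁ ≃* Π₂` (the `Π`-level isomorphism induced by `Ψ^Base`, [Mzk2] step of p. 19;
print's `G₁ ⥲ G₂` is its image under Thm. 1.2 (ii), not typed here), a cofinal antitone `N₂` for `Π₂`, and
`e : lim→_k K_{1,Π₁/N_k}^× ≅ lim→_k K_{2,Π₂/N₂,k}^×` ("`K̄₁^× ⥲ K̄₂^×`") with `e ∘ r_g = r_{φ g} ∘ e` for every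
`g ∈ Π₁` — abc-iut-w5-d194's `exists_pairIso` with its five `HasColimit` hypotheses discharged by
`hasColimitsOfShape_nat_commMonCat`. [cite: MochizukiFrdII2008, Thm 2.4 (ii) p.21] -/
theorem exists_pairIso_of_isFieldwiseSaturated (hfs₁ : d₁.IsFieldwiseSaturated) (hfs₂ : d₂.IsFieldwiseSaturated)
    (E : CosetCat G ≌ CosetCat G₂) (ΨB : d₁.B ≅ E.functor.op ⋙ d₂.B)
    (hNb : ∀ U ∈ 𝓝 (1 : G), ∃ k, (N k : Set G) ⊆ U) :
    haveI := hasColimitsOfShape_nat_commMonCat.{u}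
    ∃ (φ : G ≃* G₂) (N₂ : ℕ → OpenNormalSubgroup G₂) (hN₂ : Antitone N₂)
      (_ : ∀ U ∈ 𝓝 (1 : G₂), ∃ k, (N₂ k : Set G₂) ⊆ U)
      (e : colimit (cosetSystem N hN ⋙ PadicFrd.bZeroOn d₁.base) ≅
        colimit (cosetSystem N₂ hN₂ ⋙ PadicFrd.bZeroOn d₂.base)),
      ∀ g : G, e.hom ≫ colimMap (Functor.whiskerRight (toAutCoset N₂ hN₂ (φ g)).hom (PadicFrd.bZeroOn d₂.base)) =
        colimMap (Functor.whiskerRight (toAutCoset N hN g).hom (PadicFrd.bZeroOn d₁.base)) ≫ e.hom := by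
  haveI := hasColimitsOfShape_nat_commMonCat.{u}
  exact exists_pairIso hG hG₂ N hN d₁ d₂ hfs₁ hfs₂ E ΨB hNb (fun _ _ => inferInstance)

include hG hG₂ in
/-- **[FrdII] Thm. 2.4 (ii), "`Ψ` induces … `G₁ ⥲ G₂`" for Galois-countable `Π₁`, no chosen covering:** for fieldwise
saturated data as above there are cofinal antitone `N`, `N₂`, `φ : Π₁ ≃* Π₂` and a `φ`-equivariant
`e : lim→_k K_{1,Π₁/N_k}^× ≅ lim→_k K_{2,Π₂/N₂,k}^×` (the universal pro-covering of `Π₁` chosen by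
`exists_antitone_cofinal_seq`). [cite: MochizukiFrdII2008, Thm 2.4 (ii) p.21] -/
theorem exists_pairIso_of_isFieldwiseSaturated' [IsTopologicalGroup G] [SecondCountableTopology G]
    (hfs₁ : d₁.IsFieldwiseSaturated) (hfs₂ : d₂.IsFieldwiseSaturated)
    (E : CosetCat G ≌ CosetCat G₂) (ΨB : d₁.B ≅ E.functor.op ⋙ d₂.B) :
    haveI := hasColimitsOfShape_nat_commMonCat.{u}
    ∃ (N : ℕ → OpenNormalSubgroup G) (hN : Antitone N) (_ : ∀ U ∈ 𝓝 (1 : G), ∃ k, (N k : Set G) ⊆ U)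
      (φ : G ≃* G₂) (N₂ : ℕ → OpenNormalSubgroup G₂) (hN₂ : Antitone N₂)
      (_ : ∀ U ∈ 𝓝 (1 : G₂), ∃ k, (N₂ k : Set G₂) ⊆ U)
      (e : colimit (cosetSystem N hN ⋙ PadicFrd.bZeroOn d₁.base) ≅
        colimit (cosetSystem N₂ hN₂ ⋙ PadicFrd.bZeroOn d₂.base)),
      ∀ g : G, e.hom ≫ colimMap (Functor.whiskerRight (toAutCoset N₂ hN₂ (φ g)).hom (PadicFrd.bZeroOn d₂.base)) =
        colimMap (Functor.whiskerRight (toAutCoset N hN g).hom (PadicFrd.bZeroOn d₁.base)) ≫ e.hom := by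
  haveI := hasColimitsOfShape_nat_commMonCat.{u}
  obtain ⟨N, hN, hNb⟩ := exists_antitone_cofinal_seq hG
  obtain ⟨φ, N₂, hN₂, hN₂b, e, he⟩ :=
    exists_pairIso_of_isFieldwiseSaturated hG hG₂ N hN d₁ d₂ hfs₁ hfs₂ E ΨB hNb
  exact ⟨N, hN, hNb, φ, N₂, hN₂, hN₂b, e, he⟩

end BaseGaloisSystem

end Literature.AlgebraicGeometry.Frobenioids

end
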